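import Literature.MathematicalPhysics.QuantumLattice.SectorEigenvalueContinuation
import HarnessLib

/-!
# Continuity of ground-state observables along a continuous family with simple sector ground states

Family `hubbard` (trunk T-QLATTICE); companion of `SectorEigenvalueContinuation` (Lieb–Wu's
continuity principle for a simple lowest eigenvalue). That file continues the EIGENVALUE; this one
proves the corresponding statement for the ground STATE, in the minimal finite-dimensional form in
which it is used for lattice models at fixed volume (Kato's continuity of a simple eigenprojection,
Perturbation Theory for Linear Operators, II-§1.4 and II-§5.1, obtained here by compactness instead
of resolvents):

* `abs_sectorMin_sub_le` — along a family `u ↦ A u` whose quadratic forms on a subspace `K` are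
  `d`-Lipschitz in `u` on `S`, a sector minimum `m` (a lower bound of the energy on `K` attained at a
  normalised eigenvector of `K`) is `d`-Lipschitz on `S` (the variational step of
  `eigenvalue_eq_sectorMin_of_continuousOn`, isolated);
* `continuousOn_groundState_observable` — if moreover `A` is continuous and the ground state of
  `A u` in `K` is unique up to scalars for every `u ∈ S`, then for every observable of states `F`
  that is continuous at ground states and phase blind (`F (c ψ) = F ψ`, `|c| = 1`), any function `g`
  with `g u = F ψ` for all normalised ground states `ψ` at all `u ∈ S` is continuous on `S`.

Proof of the second: along `uₙ → u₀` inside `S`, normalised ground states `ψₙ` have a convergent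
subsequence (the unit sphere of `K` is compact, `isCompact_unitSphere_inter`); its limit `φ` is a
normalised vector of `K` with `A u₀ φ = m u₀ φ` (continuity of `A`, Lipschitz continuity of `m`,
uniqueness of limits), hence a unimodular multiple of the ground state at `u₀`, so
`g uₙ = F ψₙ → F φ = g u₀`; since every subsequence has such a sub-subsequence, `g uₙ → g u₀`
(`Filter.tendsto_of_subseq_tendsto` along `𝓝[S] u₀`). Pure linear algebra / topology on `ι → ℂ` with
the conventions of the `QuantumLattice` files (`⟨v, w⟩ = star v ⬝ᵥ w`, energies `Re⟨v, A v⟩`);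
no definitions. Used by the `LevyLogBootstrap` route of `HubbardSuperconductivity` (crux
`LevyTransport`, stub `stub_levyMassBranch`: continuity in the anisotropy of the Lévy mass of the
half-filled XXZ sector ground state at fixed volume).

## Sources

* T. Kato, *Perturbation Theory for Linear Operators* (Springer, 1966/1995), II-§1.4, II-§5.1
  (continuity of the eigenprojection of a simple eigenvalue in finite dimension).
* E. H. Lieb, F. Y. Wu, Physica A 321 (2003) 1–27 = arXiv:cond-mat/0207529 (key
  `LiebWuPhysicaA2003`), §2 (uniqueness of the sector ground state and continuity arguments).
-/

open Finset Matrix Metric Set Filter Topology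
open scoped ComplexOrder

namespace Literature.MathematicalPhysics.QuantumLattice

namespace EigenvalueContinuation

variable {ι : Type*} [Fintype ι]

/-- **The sector minimum is Lipschitz** along a family whose energies on `K` are `d`-Lipschitz in
the parameter (variational principle: test the ground state of `u'` in the form of `u`).
[cite: LiebWuPhysicaA2003, §2] -/
theorem abs_sectorMin_sub_le (K : Submodule ℂ (ι → ℂ)) (A : ℝ → Matrix ι ι ℂ) (m : ℝ → ℝ)
    (S : Set ℝ) {d : ℝ}
    (hlip : ∀ u ∈ S, ∀ u' ∈ S, ∀ v ∈ K,
      |(star v ⬝ᵥ A u *ᵥ v).re - (star v ⬝ᵥ A u' *ᵥ v).re| ≤ d * |u - u'| * (star v ⬝ᵥ v).re)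
    (hmle : ∀ u ∈ S, ∀ v ∈ K, m u * (star v ⬝ᵥ v).re ≤ (star v ⬝ᵥ A u *ᵥ v).re)
    (hgs : ∀ u ∈ S, ∃ ψ ∈ K, star ψ ⬝ᵥ ψ = 1 ∧ A u *ᵥ ψ = (m u : ℂ) • ψ) :
    ∀ u ∈ S, ∀ u' ∈ S, |m u - m u'| ≤ d * |u - u'| := by
  have hmlip : ∀ u ∈ S, ∀ u' ∈ S, m u ≤ m u' + d * |u - u'| := by
    intro u hu u' hu'
    obtain ⟨ψ, hψK, hψ1, hψ⟩ := hgs u' hu'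
    have h1 := hmle u hu ψ hψK
    have h2 := hlip u hu u' hu' ψ hψK
    rw [re_star_dotProduct_mulVec_of_eigen hψ, hψ1, Complex.one_re, mul_one, mul_one] at h2
    rw [hψ1, Complex.one_re, mul_one] at h1
    have h3 := (abs_le.1 h2).2
    linarith
  intro u hu u' hu'
  rw [abs_le]
  have h1 := hmlip u hu u' hu'
  have h2 := hmlip u' hu' u hu
  rw [abs_sub_comm] at h2
  constructor <;> linarith

/-- **Continuity of ground-state observables along a continuous family with simple sector ground
states.** Let `u ↦ A u` be a continuous family of matrices whose quadratic forms on a subspace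
`K` are `d`-Lipschitz in `u` on `S ⊆ ℝ`; let `m u` be a lower bound of the energy on `K` attained at
a normalised eigenvector of `K` (`A u ψ = m u ψ`), unique up to scalars, for every `u ∈ S`. Let
`F` be an observable of states that is continuous at the ground states and blind to phases
(`F (c ψ) = F ψ`, `|c| = 1`), and `g : ℝ → ℝ` any function with `g u = F ψ` for every normalised
ground state `ψ` at every `u ∈ S`. Then `g` is continuous on `S`. Proof: along `uₙ → u₀` in `S`,
normalised ground states `ψₙ` have a convergent subsequence (compact unit sphere of `K`); its limit
`φ` satisfies `A u₀ φ = m u₀ φ` (continuity of `A`, Lipschitz continuity of `m`), so `φ` is a unit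
multiple of the ground state at `u₀` and `g uₙ = F ψₙ → F φ = g u₀`; every subsequence having such
a sub-subsequence, `g uₙ → g u₀`. (The continuity principle behind Kato's analytic perturbation
theory of a simple eigenvalue, in the minimal form needed for finite systems.)
[cite: LiebWuPhysicaA2003, §2] -/
theorem continuousOn_groundState_observable (K : Submodule ℂ (ι → ℂ))
    (A : ℝ → Matrix ι ι ℂ) (hA : Continuous A) (m : ℝ → ℝ) (S : Set ℝ) {d : ℝ}
    (hlip : ∀ u ∈ S, ∀ u' ∈ S, ∀ v ∈ K,
      |(star v ⬝ᵥ A u *ᵥ v).re - (star v ⬝ᵥ A u' *ᵥ v).re| ≤ d * |u - u'| * (star v ⬝ᵥ v).re)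
    (hmle : ∀ u ∈ S, ∀ v ∈ K, m u * (star v ⬝ᵥ v).re ≤ (star v ⬝ᵥ A u *ᵥ v).re)
    (hgs : ∀ u ∈ S, ∃ ψ ∈ K, star ψ ⬝ᵥ ψ = 1 ∧ A u *ᵥ ψ = (m u : ℂ) • ψ)
    (huniq : ∀ u ∈ S, ∀ ψ₁ ∈ K, ∀ ψ₂ ∈ K, ψ₁ ≠ 0 → A u *ᵥ ψ₁ = (m u : ℂ) • ψ₁ →
      A u *ᵥ ψ₂ = (m u : ℂ) • ψ₂ → ∃ c : ℂ, ψ₂ = c • ψ₁)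
    (F : (ι → ℂ) → ℝ)
    (hFc : ∀ u ∈ S, ∀ ψ ∈ K, star ψ ⬝ᵥ ψ = 1 → A u *ᵥ ψ = (m u : ℂ) • ψ → ContinuousAt F ψ)
    (hFph : ∀ (c : ℂ) (ψ : ι → ℂ), star c * c = 1 → F (c • ψ) = F ψ)
    (g : ℝ → ℝ)
    (hg : ∀ u ∈ S, ∀ ψ ∈ K, star ψ ⬝ᵥ ψ = 1 → A u *ᵥ ψ = (m u : ℂ) • ψ → g u = F ψ) :
    ContinuousOn g S := by
  classical
  have hmabs := abs_sectorMin_sub_le K A m S hlip hmle hgs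
  intro u₀ hu₀
  -- the ground state at `u₀`
  obtain ⟨ψ₀, hψ₀K, hψ₀1, hψ₀⟩ := hgs u₀ hu₀
  have hψ₀0 : ψ₀ ≠ 0 := by
    rintro rfl
    rw [star_zero, zero_dotProduct] at hψ₀1
    exact zero_ne_one hψ₀1
  have hg0 : g u₀ = F ψ₀ := hg u₀ hu₀ ψ₀ hψ₀K hψ₀1 hψ₀
  -- sequential criterion along `𝓝[S] u₀`
  refine tendsto_of_subseq_tendsto fun ns hns => ?_
  have hns0 : Tendsto ns atTop (𝓝 u₀) := (tendsto_nhdsWithin_iff.1 hns).1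
  have hnsS : ∀ᶠ n in atTop, ns n ∈ S := (tendsto_nhdsWithin_iff.1 hns).2
  -- normalised ground states along the sequence (junk `ψ₀` off `S`)
  have hch : ∀ n, ∃ ψ ∈ K, star ψ ⬝ᵥ ψ = 1 ∧
      (ns n ∈ S → A (ns n) *ᵥ ψ = (m (ns n) : ℂ) • ψ) := by
    intro n
    by_cases hn : ns n ∈ S
    · obtain ⟨ψ, h1, h2, h3⟩ := hgs (ns n) hn
      exact ⟨ψ, h1, h2, fun _ => h3⟩
    · exact ⟨ψ₀, hψ₀K, hψ₀1, fun h => absurd h hn⟩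
  choose ψ hψK hψ1 hψeq using hch
  -- a convergent subsequence
  obtain ⟨φ, hφmem, ms, hms, hlim⟩ :=
    (isCompact_unitSphere_inter K).tendsto_subseq (x := ψ) (fun n => ⟨hψK n, hψ1 n⟩)
  refine ⟨ms, ?_⟩
  obtain ⟨hφK, hφ1⟩ := hφmem
  have hv : Tendsto (fun k => ns (ms k)) atTop (𝓝 u₀) := hns0.comp hms.tendsto_atTop
  have hvS : ∀ᶠ k in atTop, ns (ms k) ∈ S := hms.tendsto_atTop.eventually hnsS
  -- `m (ns (ms k)) → m u₀`
  have hm : Tendsto (fun k => m (ns (ms k))) atTop (𝓝 (m u₀)) := by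
    rw [Metric.tendsto_atTop]
    intro ε hε
    have hv' := Metric.tendsto_atTop.1 hv
    by_cases hd : d ≤ 0
    · obtain ⟨N, hN⟩ := hvS.exists_forall_of_atTop
      refine ⟨N, fun k hk => ?_⟩
      have h := hmabs (ns (ms k)) (hN k hk) u₀ hu₀
      have : d * |ns (ms k) - u₀| ≤ 0 := mul_nonpos_of_nonpos_of_nonneg hd (abs_nonneg _)
      rw [Real.dist_eq]
      linarith
    · have hd : 0 < d := not_le.mp hd
      obtain ⟨N₁, hN₁⟩ := hvS.exists_forall_of_atTop
      obtain ⟨N₂, hN₂⟩ := hv' (ε / d) (by positivity)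
      refine ⟨max N₁ N₂, fun k hk => ?_⟩
      have hk1 : N₁ ≤ k := le_trans (le_max_left _ _) hk
      have hk2 : N₂ ≤ k := le_trans (le_max_right _ _) hk
      have h := hmabs (ns (ms k)) (hN₁ k hk1) u₀ hu₀
      have h2 := hN₂ k hk2
      rw [Real.dist_eq] at h2 ⊢
      calc |m (ns (ms k)) - m u₀| ≤ d * |ns (ms k) - u₀| := h
        _ < d * (ε / d) := mul_lt_mul_of_pos_left h2 hd
        _ = ε := by field_simp
  -- the limit vector is a ground state at `u₀`
  have hL : Tendsto (fun k => A (ns (ms k)) *ᵥ ψ (ms k)) atTop (𝓝 (A u₀ *ᵥ φ)) := by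
    rw [tendsto_pi_nhds]
    intro i
    simp only [mulVec, dotProduct]
    refine tendsto_finsetSum _ fun j _ => Tendsto.mul ?_ ?_
    · exact ((hA.matrix_elem i j).tendsto u₀).comp hv
    · exact ((continuous_apply j).tendsto φ).comp hlim
  have hR : Tendsto (fun k => (m (ns (ms k)) : ℂ) • ψ (ms k)) atTop (𝓝 ((m u₀ : ℂ) • φ)) :=
    ((Complex.continuous_ofReal.tendsto (m u₀)).comp hm).smul hlim
  have heq : (fun k => A (ns (ms k)) *ᵥ ψ (ms k)) =ᶠ[atTop]
      (fun k => (m (ns (ms k)) : ℂ) • ψ (ms k)) :=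
    hvS.mono fun k hk => hψeq (ms k) hk
  have hφeig : A u₀ *ᵥ φ = (m u₀ : ℂ) • φ := tendsto_nhds_unique_of_eventuallyEq hL hR heq
  -- hence a unit multiple of `ψ₀`
  obtain ⟨c, hc⟩ := huniq u₀ hu₀ ψ₀ hψ₀K φ hφK hψ₀0 hψ₀ hφeig
  have hcc : star c * c = 1 := by
    have h := hφ1
    rw [hc, star_smul, smul_dotProduct, dotProduct_smul, smul_smul, hψ₀1, smul_eq_mul,
      mul_one] at h
    exact h
  have hFφ : F φ = g u₀ := by rw [hg0, hc, hFph c ψ₀ hcc]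
  -- conclude: `g (ns (ms k)) = F (ψ (ms k)) → F φ = g u₀`
  have hFlim : Tendsto (fun k => F (ψ (ms k))) atTop (𝓝 (F φ)) :=
    (hFc u₀ hu₀ φ hφK hφ1 hφeig).tendsto.comp hlim
  rw [← hFφ]
  refine hFlim.congr' ?_
  exact hvS.mono fun k hk => (hg (ns (ms k)) hk (ψ (ms k)) (hψK (ms k)) (hψ1 (ms k))
    (hψeq (ms k) hk)).symm

end EigenvalueContinuation

end Literature.MathematicalPhysics.QuantumLattice
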